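import Literature.MathematicalPhysics.QuantumFieldTheory.Balaban1983to89.B11Eq80CurrentTwoCarriers

/-!
# `Balaban1983to89.B11Eq98W80BackgroundModulus` — T. Bałaban, *The variational problem and background fields in renormalization group method for lattice gauge theories*, Commun. Math. Phys. **102** (1985) 277–309 [Balaban1985Variational]: Prop. 4 (97)–(98) p. 292–293 with Prop. 6 (117)–(121) p. 295 and [Balaban1985BackgroundPropagators] Thm 3.4 p. 400 — THE BACKGROUND MODULUS OF `W = (δ/δA′)V` REDUCED TO LETTER MODULI: `‖W(…₁)(P) − W(…₂)(ιP)‖₍₋₃₎ ≤ K·(δ_T + δ_Q + δ_Δ + δ_V)` on every ball under two explicit radius caps, with `K` chosen BEFORE the two carriers and all operator letters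

statement-level skeleton of published theorems with citation tags; proofs where landed; nothing here is a claim about the Yang–Mills mass gap

PDF held: `paper:balaban1985-cmp102-variational-background` (journal page = PDF page + 276); pp. 290–295 read on the text layer by this lineage;
`paper:balaban1985-cmp99-background-propagators` p. 400 Thm 3.4 (*«analytic functions of A»*, the background dependence of the operators).

CITATION HEADER (lean-in-tree rule 2026-08-18).  WHAT IS REPRODUCED: nothing of print is asserted.  Print's Prop. 4 p. 292 states that `(δ/δA′)V(A′)`
is analytic with the (98) bound; its dependence on the BACKGROUND enters the renormalization-group analysis through [Balaban1985BackgroundPropagators]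
Thm 3.4 (the propagators as analytic functions of the background) and the explicit plaquette variables of the V₀-group (90)–(96).  The pub-balaban NE9
chain's OWNER leaf `NE9CurChartLipschitzAtFlat` DISPLAYS exactly one modulus of that dependence, «δ_W (leaf-05's W80)»:
`∀ P, ‖P‖ < r → ‖W_U P − W_1(ιP)‖ ≤ δ_W` for the (L3) slots at a background `U` and at the flat background, `ι` the jet identity between the two
(115) norms.  THIS FILE supplies that binder's shape for `W := W80` (this lineage's `B11Eq80Current.W80 = W1 + W2 + W3 + curV0full`) at the UNIFORM
LETTERS of `B11Ineq73KernelLettersUniform.exists_quadAnalytic_W80_uniform`, modulo four DISPLAYED letter moduli.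

WHAT IS PROVED (sorry-free; axioms standard; 0 def).  **`exists_W80_background_modulus`**: for scalar letters `b, C₂, c₄, a_C > 0, ε_C ≥ 0` with
`4bC₂(ε_C + a_C) < 1`, `C_V ≥ 0`, `R_V > 0`, bounds `M_ρ, M_τ, M_J, M_Δ, M_D ≥ 0` and `K_ι ≥ 1`, THERE IS `K > 0` (depending on these and on the lattice
weights only) such that for EVERY radius `r ≤ a_C∕(2K_ι²)`, `r ≤ R_V∕(4K_ιℓ)` (`ℓ = 1∕(1 − 4bC₂(ε_C + a_C))`; the consumer's own ball — e.g. (Z)'s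
`ε₄ + a′`), EVERY pair of derivative letters `Dc₁, Dc₂` of the lattice (`‖Dc₂ g‖ ≤ M_D‖g‖`; jet identities `‖ιP‖ ≤ K_ι‖P‖`,
`‖ι⁻¹Q‖ ≤ K_ι‖Q‖`), EVERY pair of Sect. C regimes `Regime H_i 0 C_i b 0 C₂ c₄ 0 a_C ε_C` with `Prop4Hyp C_i C₂ c₄`, ALL letters `ρ, τ, U₁, U₂, J, Δ_π₁, Δ_π₂`
within their bounds (`‖curV0 ρ τ U_i Y‖ ≤ C_V‖Y‖²` on `‖Y‖ < R_V`), and ALL moduli `δ_T, δ_Q, δ_Δ, δ_V ≥ 0` with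
(δ_T) `‖ι(x + 𝒜_C,1(x)) − (ιx + 𝒜_C,2(ιx))‖ ≤ δ_T` on `‖x‖ < a_C ∧ ‖ιx‖ < a_C` (the Sect. C map (47) across the carriers — the OWNER's
      `B11Eq120SolutionContinuity.norm_map_sectC_sub_le` at `y := ιx`),
(δ_Q) `‖ι(H₁C₁^{(2)}(x)) − H₂C₂^{(2)}(ιx)‖ ≤ δ_Q` on the same ball (the quadratic letter `HC^{(2)}` of (78), `B11Eq80Current.quadPart`),
(δ_Δ) `‖Δ_π₁ Y − Δ_π₂(ιY)‖ ≤ δ_Δ‖Y‖` (the letter `Δ_π` of [5] (3.119) across the carriers),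
(δ_V) `‖curV0 ρ τ U₁ Y − curV0 ρ τ U₂ (ιY)‖ ≤ δ_V` on `‖Y‖ < R_V` (the V₀-group's background modulus — this lineage's next file):
**`∀ P, ‖P‖ < r → ‖W80 ρ τ U₁ H₁ C₁ ε_C J Δ_π₁ P − W80 ρ τ U₂ H₂ C₂ ε_C J Δ_π₂ (ιP)‖₍₋₃₎ ≤ K·(δ_T + δ_Q + δ_Δ + δ_V)`**.
MECHANISM ([folklore]): `B11Eq80CurrentTwoCarriers` (transposes moved to carrier 2 by `transCur_conj`; the operator defects `‖ιD(HD)₁ι⁻¹ − D(HD)₂‖`,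
`‖ιD(HD₃)₁ι⁻¹ − D(HD₃)₂‖`, `‖ιDT₁ι⁻¹ − DT₂‖` at `ιP` by CAUCHY on `‖Q‖ < a_C/K_ι` from the value moduli `δ_T`, `δ_T + δ_Q`; `‖D(HD)₂‖ ≤ 2ε_C/a_C`, `‖DT₂‖ ≤
2(a_C + ε_C)/a_C` by Cauchy from (51)/(57); the V₀-group by `δ_V` and the `2C_VR_V`-Lipschitz bound of the entire `curV0`); the column constant `κ̄(M_D)` of
`B11Ineq73KernelLettersUniform.colConst_le`; `r = min (a_C/(2K_ι²)) (R_V/(4K_ιℓ))`, `ℓ = 1/(1 − 4bC₂(ε_C + a_C))`; §1's elaboration budget is raised ×5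
(every occurrence of the explicit jet-identity term re-synthesises the finite-dimensional CLM instances; no search tactic, no `decide`).

HONEST SCOPE — what is NOT claimed.  (i) `K` is a crude finite-lattice number (`κ̄` is a double bond sum, NO decay — NOT print's «d and L only» of
(97)); nothing of Prop. 4 ∕ (98) ∕ Thm 3.4 is proved.  (ii) `δ_T, δ_Q, δ_Δ, δ_V` are DISPLAYED: `δ_T` has a supplier (the OWNER's (B) §4 with
`B11Eq44COperatorModulus` / `B11Eq117LetterDefects`), `δ_Q` and `δ_V` do not yet (this lineage's next files), `Δ_π` is a letter of the one-instance
face.  (iii) The two regimes carry the SAME scalar letters (as `B11Eq118RegimeScalars` delivers them at `U` and at `1`).  (iv) NOT summit progress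
(cell pub-balaban: NE9 NOT PRINTED ∕ NOT PROVED; «NE9 ⇐ the named binders»; spine PROVED 0/9; HONEST DEPENDENCY: continuum YM on T⁴ ⇐ BetaPertH ∧ nine
spine estimates (0/9 proved); BetaPertH ⇐ (D1) ∧ (D4) ∧ CAP+tail; G-an2-4 gates asym, D1 and NE2/3/4).  Unit `b2b-balaban-t4-ne9-formalise-leaf-05`
(NE9 crux-team leaf prover, gen 70).  Imports `B11Eq80CurrentTwoCarriers` ONLY; modifies nothing.
-/

noncomputable section

open Metric Set Filter Topology

namespace Literature.MathematicalPhysics.QuantumFieldTheory.Balaban1983to89.B11Eq98W80BackgroundModulus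

open Literature.MathematicalPhysics.QuantumFieldTheory.Balaban1983to89.B11Prop6Scheme (Prop4Hyp)
open Literature.MathematicalPhysics.QuantumFieldTheory.Balaban1983to89.B11Eq174Chart (solA Regime)
open Literature.MathematicalPhysics.QuantumFieldTheory.Balaban1983to89.B11Eq90V0primeCurrent (flat115 differentiable_curV0prime)
open Literature.MathematicalPhysics.QuantumFieldTheory.Balaban1983to89.B11Eq96CommutatorCurrent (differentiable_curComm)
open Literature.MathematicalPhysics.QuantumFieldTheory.Balaban1983to89.B11Eq90Transpose (kernel)
open Literature.MathematicalPhysics.QuantumFieldTheory.Balaban1983to89.B11Eq90V0GroupComposed (T47 T47_apply norm_solA_le norm_T47_le norm_T47_lt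
  differentiableOn_T47)
open Literature.MathematicalPhysics.QuantumFieldTheory.Balaban1983to89.B11Eq63V0GroupCurrent (curV0)
open Literature.MathematicalPhysics.QuantumFieldTheory.Balaban1983to89.B11Eq80Current (Emap quadPart E3 W80 analyticOnNhd_Emap analyticOnNhd_E3)
open Literature.MathematicalPhysics.QuantumFieldTheory.Balaban1983to89.B11Eq111FrakG (jetLinearEquiv)
open Literature.MathematicalPhysics.QuantumFieldTheory.Balaban1983to89.B11Ineq73KernelLettersPerLattice (colSum_kernel_le)
open Literature.MathematicalPhysics.QuantumFieldTheory.Balaban1983to89.B11Ineq73KernelLettersUniform (colConst_le)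
open Literature.MathematicalPhysics.QuantumFieldTheory.Balaban1983to89.B11Eq80CurrentTwoCarriers
open B9SectCLatticeCarrier (Bond)
open B11Eq115Space

variable {𝔸 : Type*} [NormedRing 𝔸] [NormedAlgebra ℂ 𝔸] [FiniteDimensional ℂ 𝔸]
variable {d : ℕ} {Pd : Fin d → ℕ} {L η : ℝ} [Fact (0 < L)] [Fact (0 < η)] {lev₀ : Bond d Pd → ℕ} {κ' : Type*} [Fintype κ']
  {lev₁ : κ' → ℕ}
variable {𝒳 : Type*} [NormedAddCommGroup 𝒳] [NormedSpace ℂ 𝒳]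

/-! ## §1 At a point, with the column constant of the second carrier as a letter -/

section Point

variable {Dc₁ Dc₂ : (Bond d Pd → 𝔸) →ₗ[ℂ] (κ' → 𝔸)}

variable [CompleteSpace 𝒳] [CompleteSpace 𝔸] {b C₂ c₄ aC εC CV RV Mρ Mτ MJ MΔ Kι κc r δT δQ δΔ δV : ℝ}
  {H₁ : 𝒳 →L[ℂ] Space115 L η lev₀ lev₁ Dc₁} {C₁ : Space115 L η lev₀ lev₁ Dc₁ → 𝒳}
  {H₂ : 𝒳 →L[ℂ] Space115 L η lev₀ lev₁ Dc₂} {C₂' : Space115 L η lev₀ lev₁ Dc₂ → 𝒳}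
  {ρ : (𝔸 →L[ℂ] ℂ) →L[ℂ] 𝔸} {τ : 𝔸 →L[ℂ] ℂ} {U₁ U₂ : Bond d Pd → 𝔸ˣ} {J : NegSize L η lev₀ 3 𝔸}
  {Δπ₁ : Space115 L η lev₀ lev₁ Dc₁ →L[ℂ] NegSize L η lev₀ 3 𝔸} {Δπ₂ : Space115 L η lev₀ lev₁ Dc₂ →L[ℂ] NegSize L η lev₀ 3 𝔸}

set_option maxHeartbeats 1000000 in
/-- **THE REDUCTION AT A POINT, WITH AN EXPLICIT CONSTANT** — the body of `exists_W80_background_modulus` with the column constant `κ` of the second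
carrier as a letter (`Σ_{b′}(w₃(b)/w₃(b′))‖k_N(b′, b)‖ ≤ κ‖N‖`) and the radius conditions `r ≤ a_C/(2K_ι²)`, `r ≤ R_V/(4K_ιℓ)` displayed:
on `‖P‖ < r`, `‖W80(…₁)(P) − W80(…₂)(ιP)‖₍₋₃₎ ≤ K(M_ρ, M_τ, κ, M_J, M_Δ, ε_C, a_C, C_V, R_V, K_ι)·(δ_T + δ_Q + δ_Δ + δ_V)` with the polynomial constant
written out. [folklore] [cite: Balaban1985Variational, Prop. 4 (97)–(98) pp.292–293, Prop. 6 (117)–(121) p.295] -/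
theorem norm_W80_sub_W80_le_at (haC : 0 < aC) (hεC : 0 ≤ εC) (hcontr : 4 * b * C₂ * (εC + aC) < 1) (hCV : 0 ≤ CV) (hRV : 0 < RV)
    (hMρ : 0 ≤ Mρ) (hMΔ : 0 ≤ MΔ) (hKι : 1 ≤ Kι) (hκ0 : 0 ≤ κc)
    (hκ : ∀ (N : Space115 L η lev₀ lev₁ Dc₂ →L[ℂ] Space115 L η lev₀ lev₁ Dc₂) (bb : Bond d Pd),
      ∑ b' : Bond d Pd, levWeight L η lev₀ 3 bb / levWeight L η lev₀ 3 b' * ‖kernel N b' bb‖ ≤ κc * ‖N‖)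
    (hι : ∀ P : Space115 L η lev₀ lev₁ Dc₁, ‖(LinearMap.toContinuousLinearMap ((jetLinearEquiv L η lev₀ lev₁ Dc₂).symm.toLinearMap ∘ₗ (jetLinearEquiv L η lev₀ lev₁ Dc₁).toLinearMap)) P‖ ≤ Kι * ‖P‖) (hκι : ∀ Q : Space115 L η lev₀ lev₁ Dc₂, ‖(LinearMap.toContinuousLinearMap ((jetLinearEquiv L η lev₀ lev₁ Dc₁).symm.toLinearMap ∘ₗ (jetLinearEquiv L η lev₀ lev₁ Dc₂).toLinearMap)) Q‖ ≤ Kι * ‖Q‖)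
    (RC₁ : Regime H₁ 0 C₁ b 0 C₂ c₄ 0 aC εC) (hC₁ : Prop4Hyp C₁ C₂ c₄) (RC₂ : Regime H₂ 0 C₂' b 0 C₂ c₄ 0 aC εC) (hC₂ : Prop4Hyp C₂' C₂ c₄)
    (hρ : ‖ρ‖ ≤ Mρ) (hτ : ‖τ‖ ≤ Mτ)
    (hqV₁ : ∀ Y : Space115 L η lev₀ lev₁ Dc₁, ‖Y‖ < RV → ‖curV0 (lev₁ := lev₁) (Dc := Dc₁) ρ τ U₁ Y‖ ≤ CV * ‖Y‖ ^ 2)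
    (hqV₂ : ∀ Y : Space115 L η lev₀ lev₁ Dc₂, ‖Y‖ < RV → ‖curV0 (lev₁ := lev₁) (Dc := Dc₂) ρ τ U₂ Y‖ ≤ CV * ‖Y‖ ^ 2)
    (hJ : ‖J‖ ≤ MJ) (hΔ₁ : ‖Δπ₁‖ ≤ MΔ) (hΔ₂ : ‖Δπ₂‖ ≤ MΔ) (hδT : 0 ≤ δT) (hδQ : 0 ≤ δQ) (hδΔ : 0 ≤ δΔ) (hδV : 0 ≤ δV)
    (hmT : ∀ x : Space115 L η lev₀ lev₁ Dc₁, ‖x‖ < aC → ‖(LinearMap.toContinuousLinearMap ((jetLinearEquiv L η lev₀ lev₁ Dc₂).symm.toLinearMap ∘ₗ (jetLinearEquiv L η lev₀ lev₁ Dc₁).toLinearMap)) x‖ < aC →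
      ‖(LinearMap.toContinuousLinearMap ((jetLinearEquiv L η lev₀ lev₁ Dc₂).symm.toLinearMap ∘ₗ (jetLinearEquiv L η lev₀ lev₁ Dc₁).toLinearMap)) (x + solA H₁ 0 C₁ 0 εC x) - ((LinearMap.toContinuousLinearMap ((jetLinearEquiv L η lev₀ lev₁ Dc₂).symm.toLinearMap ∘ₗ (jetLinearEquiv L η lev₀ lev₁ Dc₁).toLinearMap)) x + solA H₂ 0 C₂' 0 εC ((LinearMap.toContinuousLinearMap ((jetLinearEquiv L η lev₀ lev₁ Dc₂).symm.toLinearMap ∘ₗ (jetLinearEquiv L η lev₀ lev₁ Dc₁).toLinearMap)) x))‖ ≤ δT)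
    (hmQ : ∀ x : Space115 L η lev₀ lev₁ Dc₁, ‖x‖ < aC → ‖(LinearMap.toContinuousLinearMap ((jetLinearEquiv L η lev₀ lev₁ Dc₂).symm.toLinearMap ∘ₗ (jetLinearEquiv L η lev₀ lev₁ Dc₁).toLinearMap)) x‖ < aC → ‖(LinearMap.toContinuousLinearMap ((jetLinearEquiv L η lev₀ lev₁ Dc₂).symm.toLinearMap ∘ₗ (jetLinearEquiv L η lev₀ lev₁ Dc₁).toLinearMap)) (H₁ (quadPart C₁ x)) - H₂ (quadPart C₂' ((LinearMap.toContinuousLinearMap ((jetLinearEquiv L η lev₀ lev₁ Dc₂).symm.toLinearMap ∘ₗ (jetLinearEquiv L η lev₀ lev₁ Dc₁).toLinearMap)) x))‖ ≤ δQ)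
    (hmΔ : ∀ Y : Space115 L η lev₀ lev₁ Dc₁, ‖Δπ₁ Y - Δπ₂ ((LinearMap.toContinuousLinearMap ((jetLinearEquiv L η lev₀ lev₁ Dc₂).symm.toLinearMap ∘ₗ (jetLinearEquiv L η lev₀ lev₁ Dc₁).toLinearMap)) Y)‖ ≤ δΔ * ‖Y‖)
    (hmV : ∀ Y : Space115 L η lev₀ lev₁ Dc₁, ‖Y‖ < RV →
      ‖curV0 (lev₁ := lev₁) (Dc := Dc₁) ρ τ U₁ Y - curV0 (lev₁ := lev₁) (Dc := Dc₂) ρ τ U₂ ((LinearMap.toContinuousLinearMap ((jetLinearEquiv L η lev₀ lev₁ Dc₂).symm.toLinearMap ∘ₗ (jetLinearEquiv L η lev₀ lev₁ Dc₁).toLinearMap)) Y)‖ ≤ δV)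
    (hra : r ≤ aC / (2 * Kι ^ 2)) (hrV : r ≤ RV / (4 * Kι * (1 / (1 - 4 * b * C₂ * (εC + aC))))) {P : Space115 L η lev₀ lev₁ Dc₁}
    (hP : ‖P‖ < r) :
    ‖W80 ρ τ U₁ H₁ C₁ εC J Δπ₁ P - W80 ρ τ U₂ H₂ C₂' εC J Δπ₂ ((LinearMap.toContinuousLinearMap ((jetLinearEquiv L η lev₀ lev₁ Dc₂).symm.toLinearMap ∘ₗ (jetLinearEquiv L η lev₀ lev₁ Dc₁).toLinearMap)) P)‖ ≤
      (Mρ * Mτ * κc * (2 * Kι / aC * MJ) + ((εC + MΔ) + Mρ * Mτ * κc * (2 * Kι / aC * (MΔ * aC) + 2 * εC / aC * aC))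
          + Mρ * Mτ * κc * (2 * Kι / aC * (MΔ * εC) + 2 * εC / aC * (εC + MΔ))
          + Mρ * Mτ * κc * (2 * Kι / aC * (CV * RV ^ 2) + 2 * (aC + εC) / aC * (1 + 2 * CV * RV)) + 1) * (δT + δQ + δΔ + δV) := by
  have hKι0 : 0 < Kι := lt_of_lt_of_le one_pos hKι
  have hq : 0 < 1 - 4 * b * C₂ * (εC + aC) := by linarith
  obtain ⟨ℓ, hℓ⟩ : ∃ ℓ : ℝ, ℓ = 1 / (1 - 4 * b * C₂ * (εC + aC)) := ⟨_, rfl⟩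
  rw [← hℓ] at hrV
  have hℓ0 : 0 < ℓ := by rw [hℓ]; positivity
  have hMτ : 0 ≤ Mτ := (norm_nonneg _).trans hτ
  have hMJ : 0 ≤ MJ := (norm_nonneg _).trans hJ
  have hA0 : 0 ≤ Mρ * Mτ * κc := by positivity
  have hraC : r ≤ aC := by
    refine hra.trans ?_
    rw [div_le_iff₀ (by positivity)]
    have hK2 : (1 : ℝ) ≤ 2 * Kι ^ 2 := by nlinarith [hKι]
    nlinarith [mul_le_mul_of_nonneg_left hK2 haC.le]
  have eιι : ∀ Q : Space115 L η lev₀ lev₁ Dc₂, (LinearMap.toContinuousLinearMap ((jetLinearEquiv L η lev₀ lev₁ Dc₂).symm.toLinearMap ∘ₗ (jetLinearEquiv L η lev₀ lev₁ Dc₁).toLinearMap)) ((LinearMap.toContinuousLinearMap ((jetLinearEquiv L η lev₀ lev₁ Dc₁).symm.toLinearMap ∘ₗ (jetLinearEquiv L η lev₀ lev₁ Dc₂).toLinearMap)) Q) = Q := fun Q => rfl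
  have Δ0 : 0 ≤ δT + δQ + δΔ + δV := by positivity
  have hρτ : ‖ρ‖ * ‖τ‖ * κc ≤ Mρ * Mτ * κc := mul_le_mul_of_nonneg_right (mul_le_mul hρ hτ (norm_nonneg _) hMρ) hκ0
  obtain ⟨S, hS⟩ : ∃ S : ℝ, S = aC / Kι := ⟨_, rfl⟩
  have hS0 : 0 < S := by rw [hS]; positivity
  have hSa : S ≤ aC := by rw [hS]; exact div_le_self haC.le hKι
  have hKS : Kι * S = aC := by rw [hS, mul_div_cancel₀ _ hKι0.ne']
  have hPa : ‖P‖ < aC := hP.trans_le hraC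
  have hιP : ‖(LinearMap.toContinuousLinearMap ((jetLinearEquiv L η lev₀ lev₁ Dc₂).symm.toLinearMap ∘ₗ (jetLinearEquiv L η lev₀ lev₁ Dc₁).toLinearMap)) P‖ ≤ Kι * ‖P‖ := hι P
  have hιPS : ‖(LinearMap.toContinuousLinearMap ((jetLinearEquiv L η lev₀ lev₁ Dc₂).symm.toLinearMap ∘ₗ (jetLinearEquiv L η lev₀ lev₁ Dc₁).toLinearMap)) P‖ ≤ S / 2 := by
    have h1 : Kι * ‖P‖ ≤ Kι * (aC / (2 * Kι ^ 2)) := mul_le_mul_of_nonneg_left (hP.le.trans hra) hKι0.le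
    have h2 : Kι * (aC / (2 * Kι ^ 2)) = S / 2 := by rw [hS]; field_simp
    linarith
  have hιPS' : ‖(LinearMap.toContinuousLinearMap ((jetLinearEquiv L η lev₀ lev₁ Dc₂).symm.toLinearMap ∘ₗ (jetLinearEquiv L η lev₀ lev₁ Dc₁).toLinearMap)) P‖ < S := by linarith
  have hιPa : ‖(LinearMap.toContinuousLinearMap ((jetLinearEquiv L η lev₀ lev₁ Dc₂).symm.toLinearMap ∘ₗ (jetLinearEquiv L η lev₀ lev₁ Dc₁).toLinearMap)) P‖ < aC := hιPS'.trans_le hSa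
  have hinvS : 1 / (S - ‖(LinearMap.toContinuousLinearMap ((jetLinearEquiv L η lev₀ lev₁ Dc₂).symm.toLinearMap ∘ₗ (jetLinearEquiv L η lev₀ lev₁ Dc₁).toLinearMap)) P‖) ≤ 2 * Kι / aC := by
    rw [div_le_div_iff₀ (by linarith) haC]
    nlinarith [hιPS, hKι0.le, hKS]
  have hinva : 1 / (aC - ‖(LinearMap.toContinuousLinearMap ((jetLinearEquiv L η lev₀ lev₁ Dc₂).symm.toLinearMap ∘ₗ (jetLinearEquiv L η lev₀ lev₁ Dc₁).toLinearMap)) P‖) ≤ 2 / aC := by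
    rw [div_le_div_iff₀ (by linarith) haC]
    linarith [hιPS, hSa]
  have hE₁ : DifferentiableOn ℂ (Emap H₁ C₁ εC) (ball 0 aC) := (analyticOnNhd_Emap RC₁ hC₁).differentiableOn
  have hE₂ : DifferentiableOn ℂ (Emap H₂ C₂' εC) (ball 0 aC) := (analyticOnNhd_Emap RC₂ hC₂).differentiableOn
  have hE3₁ : DifferentiableOn ℂ (E3 H₁ C₁ εC) (ball 0 aC) := (analyticOnNhd_E3 RC₁ hC₁).differentiableOn
  have hE3₂ : DifferentiableOn ℂ (E3 H₂ C₂' εC) (ball 0 aC) := (analyticOnNhd_E3 RC₂ hC₂).differentiableOn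
  have hT₁ : DifferentiableOn ℂ (T47 H₁ C₁ εC) (ball 0 aC) := differentiableOn_T47 RC₁ hC₁
  have hT₂ : DifferentiableOn ℂ (T47 H₂ C₂' εC) (ball 0 aC) := differentiableOn_T47 RC₂ hC₂
  have nhP : ball (0 : Space115 L η lev₀ lev₁ Dc₁) aC ∈ 𝓝 P := isOpen_ball.mem_nhds (mem_ball_zero_iff.2 hPa)
  have nhQ : ball (0 : Space115 L η lev₀ lev₁ Dc₂) aC ∈ 𝓝 ((LinearMap.toContinuousLinearMap ((jetLinearEquiv L η lev₀ lev₁ Dc₂).symm.toLinearMap ∘ₗ (jetLinearEquiv L η lev₀ lev₁ Dc₁).toLinearMap)) P) := isOpen_ball.mem_nhds (mem_ball_zero_iff.2 hιPa)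
  have hxQ : ∀ Q ∈ ball (0 : Space115 L η lev₀ lev₁ Dc₂) S, ‖(LinearMap.toContinuousLinearMap ((jetLinearEquiv L η lev₀ lev₁ Dc₁).symm.toLinearMap ∘ₗ (jetLinearEquiv L η lev₀ lev₁ Dc₂).toLinearMap)) Q‖ < aC ∧ ‖(LinearMap.toContinuousLinearMap ((jetLinearEquiv L η lev₀ lev₁ Dc₂).symm.toLinearMap ∘ₗ (jetLinearEquiv L η lev₀ lev₁ Dc₁).toLinearMap)) ((LinearMap.toContinuousLinearMap ((jetLinearEquiv L η lev₀ lev₁ Dc₁).symm.toLinearMap ∘ₗ (jetLinearEquiv L η lev₀ lev₁ Dc₂).toLinearMap)) Q)‖ < aC := fun Q hQ => by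
    have hQ' := mem_ball_zero_iff.1 hQ
    refine ⟨(hκι Q).trans_lt ((mul_lt_mul_of_pos_left hQ' hKι0).trans_le hKS.le), ?_⟩
    rw [eιι]; exact hQ'.trans_le hSa
  -- the three value moduli on the ball `‖Q‖ < S`
  have hGT : ∀ Q ∈ ball (0 : Space115 L η lev₀ lev₁ Dc₂) S, ‖(LinearMap.toContinuousLinearMap ((jetLinearEquiv L η lev₀ lev₁ Dc₂).symm.toLinearMap ∘ₗ (jetLinearEquiv L η lev₀ lev₁ Dc₁).toLinearMap)) (T47 H₁ C₁ εC ((LinearMap.toContinuousLinearMap ((jetLinearEquiv L η lev₀ lev₁ Dc₁).symm.toLinearMap ∘ₗ (jetLinearEquiv L η lev₀ lev₁ Dc₂).toLinearMap)) Q)) - T47 H₂ C₂' εC Q‖ ≤ δT := fun Q hQ => by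
    obtain ⟨h1, h2⟩ := hxQ Q hQ
    have h := hmT _ h1 h2
    rw [eιι] at h
    rw [T47_apply, T47_apply]
    exact h
  have hGE : ∀ Q ∈ ball (0 : Space115 L η lev₀ lev₁ Dc₂) S, ‖(LinearMap.toContinuousLinearMap ((jetLinearEquiv L η lev₀ lev₁ Dc₂).symm.toLinearMap ∘ₗ (jetLinearEquiv L η lev₀ lev₁ Dc₁).toLinearMap)) (Emap H₁ C₁ εC ((LinearMap.toContinuousLinearMap ((jetLinearEquiv L η lev₀ lev₁ Dc₁).symm.toLinearMap ∘ₗ (jetLinearEquiv L η lev₀ lev₁ Dc₂).toLinearMap)) Q)) - Emap H₂ C₂' εC Q‖ ≤ δT := fun Q hQ => by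
    have h := hGT Q hQ
    have e : (LinearMap.toContinuousLinearMap ((jetLinearEquiv L η lev₀ lev₁ Dc₂).symm.toLinearMap ∘ₗ (jetLinearEquiv L η lev₀ lev₁ Dc₁).toLinearMap)) (T47 H₁ C₁ εC ((LinearMap.toContinuousLinearMap ((jetLinearEquiv L η lev₀ lev₁ Dc₁).symm.toLinearMap ∘ₗ (jetLinearEquiv L η lev₀ lev₁ Dc₂).toLinearMap)) Q)) - T47 H₂ C₂' εC Q = -((LinearMap.toContinuousLinearMap ((jetLinearEquiv L η lev₀ lev₁ Dc₂).symm.toLinearMap ∘ₗ (jetLinearEquiv L η lev₀ lev₁ Dc₁).toLinearMap)) (Emap H₁ C₁ εC ((LinearMap.toContinuousLinearMap ((jetLinearEquiv L η lev₀ lev₁ Dc₁).symm.toLinearMap ∘ₗ (jetLinearEquiv L η lev₀ lev₁ Dc₂).toLinearMap)) Q)) - Emap H₂ C₂' εC Q) := by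
      rw [T47_apply, T47_apply, Emap, Emap, map_add, eιι, map_neg]; abel
    rwa [e, norm_neg] at h
  have hG3 : ∀ Q ∈ ball (0 : Space115 L η lev₀ lev₁ Dc₂) S, ‖(LinearMap.toContinuousLinearMap ((jetLinearEquiv L η lev₀ lev₁ Dc₂).symm.toLinearMap ∘ₗ (jetLinearEquiv L η lev₀ lev₁ Dc₁).toLinearMap)) (E3 H₁ C₁ εC ((LinearMap.toContinuousLinearMap ((jetLinearEquiv L η lev₀ lev₁ Dc₁).symm.toLinearMap ∘ₗ (jetLinearEquiv L η lev₀ lev₁ Dc₂).toLinearMap)) Q)) - E3 H₂ C₂' εC Q‖ ≤ δT + δQ := fun Q hQ => by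
    obtain ⟨h1, h2⟩ := hxQ Q hQ
    have hq' := hmQ _ h1 h2
    rw [eιι] at hq'
    have e : (LinearMap.toContinuousLinearMap ((jetLinearEquiv L η lev₀ lev₁ Dc₂).symm.toLinearMap ∘ₗ (jetLinearEquiv L η lev₀ lev₁ Dc₁).toLinearMap)) (E3 H₁ C₁ εC ((LinearMap.toContinuousLinearMap ((jetLinearEquiv L η lev₀ lev₁ Dc₁).symm.toLinearMap ∘ₗ (jetLinearEquiv L η lev₀ lev₁ Dc₂).toLinearMap)) Q)) - E3 H₂ C₂' εC Q =
        ((LinearMap.toContinuousLinearMap ((jetLinearEquiv L η lev₀ lev₁ Dc₂).symm.toLinearMap ∘ₗ (jetLinearEquiv L η lev₀ lev₁ Dc₁).toLinearMap)) (Emap H₁ C₁ εC ((LinearMap.toContinuousLinearMap ((jetLinearEquiv L η lev₀ lev₁ Dc₁).symm.toLinearMap ∘ₗ (jetLinearEquiv L η lev₀ lev₁ Dc₂).toLinearMap)) Q)) - Emap H₂ C₂' εC Q) - ((LinearMap.toContinuousLinearMap ((jetLinearEquiv L η lev₀ lev₁ Dc₂).symm.toLinearMap ∘ₗ (jetLinearEquiv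 L η lev₀ lev₁ Dc₁).toLinearMap)) (H₁ (quadPart C₁ ((LinearMap.toContinuousLinearMap ((jetLinearEquiv L η lev₀ lev₁ Dc₁).symm.toLinearMap ∘ₗ (jetLinearEquiv L η lev₀ lev₁ Dc₂).toLinearMap)) Q))) - H₂ (quadPart C₂' Q)) := by
      rw [E3, E3, map_sub]; abel
    rw [e]
    exact (norm_sub_le _ _).trans (add_le_add (hGE Q hQ) hq')
  -- the three operator defects at `ιP` by Cauchy
  have hDT := differentiableOn_conj_sub hKι0 hκι hKS.le hT₁ (hT₂.mono (ball_subset_ball hSa))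
  have hDE := differentiableOn_conj_sub hKι0 hκι hKS.le hE₁ (hE₂.mono (ball_subset_ball hSa))
  have hD3 := differentiableOn_conj_sub hKι0 hκι hKS.le hE3₁ (hE3₂.mono (ball_subset_ball hSa))
  have cauchy : ∀ {δ : ℝ}, 0 ≤ δ → δ / (S - ‖(LinearMap.toContinuousLinearMap ((jetLinearEquiv L η lev₀ lev₁ Dc₂).symm.toLinearMap ∘ₗ (jetLinearEquiv L η lev₀ lev₁ Dc₁).toLinearMap)) P‖) ≤ 2 * Kι / aC * δ := fun {δ} hδ => by
    rw [div_eq_mul_one_div]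
    calc δ * (1 / (S - ‖(LinearMap.toContinuousLinearMap ((jetLinearEquiv L η lev₀ lev₁ Dc₂).symm.toLinearMap ∘ₗ (jetLinearEquiv L η lev₀ lev₁ Dc₁).toLinearMap)) P‖)) ≤ δ * (2 * Kι / aC) := mul_le_mul_of_nonneg_left hinvS hδ
      _ = 2 * Kι / aC * δ := by ring
  have gT : ‖(LinearMap.toContinuousLinearMap ((jetLinearEquiv L η lev₀ lev₁ Dc₂).symm.toLinearMap ∘ₗ (jetLinearEquiv L η lev₀ lev₁ Dc₁).toLinearMap)).comp ((fderiv ℂ (T47 H₁ C₁ εC) P).comp (LinearMap.toContinuousLinearMap ((jetLinearEquiv L η lev₀ lev₁ Dc₁).symm.toLinearMap ∘ₗ (jetLinearEquiv L η lev₀ lev₁ Dc₂).toLinearMap))) - fderiv ℂ (T47 H₂ C₂' εC) ((LinearMap.toContinuousLinearMap ((jetLinearEquiv L η lev₀ lev₁ Dc₂).symm.toLinearMap ∘ₗ (jetLinearEquiv L η lev₀ lev₁ Dc₁).toLinearMap)) P)‖ ≤ 2 * Kι / aC * δT :=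
    (norm_conj_fderiv_sub_le hDT hGT (hT₁.differentiableAt nhP) (hT₂.differentiableAt nhQ) hιPS').trans (cauchy hδT)
  have gE : ‖(LinearMap.toContinuousLinearMap ((jetLinearEquiv L η lev₀ lev₁ Dc₂).symm.toLinearMap ∘ₗ (jetLinearEquiv L η lev₀ lev₁ Dc₁).toLinearMap)).comp ((fderiv ℂ (Emap H₁ C₁ εC) P).comp (LinearMap.toContinuousLinearMap ((jetLinearEquiv L η lev₀ lev₁ Dc₁).symm.toLinearMap ∘ₗ (jetLinearEquiv L η lev₀ lev₁ Dc₂).toLinearMap))) - fderiv ℂ (Emap H₂ C₂' εC) ((LinearMap.toContinuousLinearMap ((jetLinearEquiv L η lev₀ lev₁ Dc₂).symm.toLinearMap ∘ₗ (jetLinearEquiv L η lev₀ lev₁ Dc₁).toLinearMap)) P)‖ ≤ 2 * Kι / aC * δT :=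
    (norm_conj_fderiv_sub_le hDE hGE (hE₁.differentiableAt nhP) (hE₂.differentiableAt nhQ) hιPS').trans (cauchy hδT)
  have g3 : ‖(LinearMap.toContinuousLinearMap ((jetLinearEquiv L η lev₀ lev₁ Dc₂).symm.toLinearMap ∘ₗ (jetLinearEquiv L η lev₀ lev₁ Dc₁).toLinearMap)).comp ((fderiv ℂ (E3 H₁ C₁ εC) P).comp (LinearMap.toContinuousLinearMap ((jetLinearEquiv L η lev₀ lev₁ Dc₁).symm.toLinearMap ∘ₗ (jetLinearEquiv L η lev₀ lev₁ Dc₂).toLinearMap))) - fderiv ℂ (E3 H₂ C₂' εC) ((LinearMap.toContinuousLinearMap ((jetLinearEquiv L η lev₀ lev₁ Dc₂).symm.toLinearMap ∘ₗ (jetLinearEquiv L η lev₀ lev₁ Dc₁).toLinearMap)) P)‖ ≤ 2 * Kι / aC * (δT + δQ) :=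
    (norm_conj_fderiv_sub_le hD3 hG3 (hE3₁.differentiableAt nhP) (hE3₂.differentiableAt nhQ) hιPS').trans (cauchy (by positivity))
  have nE₁ : ‖Emap H₁ C₁ εC P‖ ≤ εC := by rw [Emap, norm_neg]; exact norm_solA_le RC₁ hPa
  have dE : ‖fderiv ℂ (Emap H₂ C₂' εC) ((LinearMap.toContinuousLinearMap ((jetLinearEquiv L η lev₀ lev₁ Dc₂).symm.toLinearMap ∘ₗ (jetLinearEquiv L η lev₀ lev₁ Dc₁).toLinearMap)) P)‖ ≤ 2 * εC / aC := by
    have hM : ∀ z ∈ ball (0 : Space115 L η lev₀ lev₁ Dc₂) aC, ‖Emap H₂ C₂' εC z‖ ≤ εC := fun z hz => by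
      rw [Emap, norm_neg]; exact norm_solA_le RC₂ (mem_ball_zero_iff.1 hz)
    refine (B8SectDSource.norm_fderiv_le_of_norm_le hE₂ hM hιPa).trans ?_
    rw [div_eq_mul_one_div]
    calc εC * (1 / (aC - ‖(LinearMap.toContinuousLinearMap ((jetLinearEquiv L η lev₀ lev₁ Dc₂).symm.toLinearMap ∘ₗ (jetLinearEquiv L η lev₀ lev₁ Dc₁).toLinearMap)) P‖)) ≤ εC * (2 / aC) := mul_le_mul_of_nonneg_left hinva hεC
      _ = 2 * εC / aC := by ring
  have dT : ‖fderiv ℂ (T47 H₂ C₂' εC) ((LinearMap.toContinuousLinearMap ((jetLinearEquiv L η lev₀ lev₁ Dc₂).symm.toLinearMap ∘ₗ (jetLinearEquiv L η lev₀ lev₁ Dc₁).toLinearMap)) P)‖ ≤ 2 * (aC + εC) / aC := by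
    have hM : ∀ z ∈ ball (0 : Space115 L η lev₀ lev₁ Dc₂) aC, ‖T47 H₂ C₂' εC z‖ ≤ εC + aC := fun z hz =>
      (norm_T47_lt RC₂ (mem_ball_zero_iff.1 hz)).le
    refine (B8SectDSource.norm_fderiv_le_of_norm_le hT₂ hM hιPa).trans ?_
    rw [div_eq_mul_one_div]
    calc (εC + aC) * (1 / (aC - ‖(LinearMap.toContinuousLinearMap ((jetLinearEquiv L η lev₀ lev₁ Dc₂).symm.toLinearMap ∘ₗ (jetLinearEquiv L η lev₀ lev₁ Dc₁).toLinearMap)) P‖)) ≤ (εC + aC) * (2 / aC) := mul_le_mul_of_nonneg_left hinva (by positivity)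
      _ = 2 * (aC + εC) / aC := by ring
  have vT : ‖(LinearMap.toContinuousLinearMap ((jetLinearEquiv L η lev₀ lev₁ Dc₂).symm.toLinearMap ∘ₗ (jetLinearEquiv L η lev₀ lev₁ Dc₁).toLinearMap)) (T47 H₁ C₁ εC P) - T47 H₂ C₂' εC ((LinearMap.toContinuousLinearMap ((jetLinearEquiv L η lev₀ lev₁ Dc₂).symm.toLinearMap ∘ₗ (jetLinearEquiv L η lev₀ lev₁ Dc₁).toLinearMap)) P)‖ ≤ δT := by
    rw [T47_apply, T47_apply]; exact hmT P hPa hιPa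
  have vE : ‖(LinearMap.toContinuousLinearMap ((jetLinearEquiv L η lev₀ lev₁ Dc₂).symm.toLinearMap ∘ₗ (jetLinearEquiv L η lev₀ lev₁ Dc₁).toLinearMap)) (Emap H₁ C₁ εC P) - Emap H₂ C₂' εC ((LinearMap.toContinuousLinearMap ((jetLinearEquiv L η lev₀ lev₁ Dc₂).symm.toLinearMap ∘ₗ (jetLinearEquiv L η lev₀ lev₁ Dc₁).toLinearMap)) P)‖ ≤ δT := hGE ((LinearMap.toContinuousLinearMap ((jetLinearEquiv L η lev₀ lev₁ Dc₂).symm.toLinearMap ∘ₗ (jetLinearEquiv L η lev₀ lev₁ Dc₁).toLinearMap)) P) (mem_ball_zero_iff.2 hιPS')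
  have aΔ : ‖Δπ₁ P - Δπ₂ ((LinearMap.toContinuousLinearMap ((jetLinearEquiv L η lev₀ lev₁ Dc₂).symm.toLinearMap ∘ₗ (jetLinearEquiv L η lev₀ lev₁ Dc₁).toLinearMap)) P)‖ ≤ δΔ * aC := (hmΔ P).trans (mul_le_mul_of_nonneg_left hPa.le hδΔ)
  have nΔ : ‖Δπ₁ P‖ ≤ MΔ * aC := (Δπ₁.le_opNorm P).trans (mul_le_mul hΔ₁ hPa.le (norm_nonneg _) hMΔ)
  have mΔ : ‖Δπ₁ (Emap H₁ C₁ εC P)‖ ≤ MΔ * εC := (Δπ₁.le_opNorm _).trans (mul_le_mul hΔ₁ nE₁ (norm_nonneg _) hMΔ)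
  have bΔ : ‖Δπ₁ (Emap H₁ C₁ εC P) - Δπ₂ (Emap H₂ C₂' εC ((LinearMap.toContinuousLinearMap ((jetLinearEquiv L η lev₀ lev₁ Dc₂).symm.toLinearMap ∘ₗ (jetLinearEquiv L η lev₀ lev₁ Dc₁).toLinearMap)) P))‖ ≤ δΔ * εC + MΔ * δT := by
    have e : Δπ₁ (Emap H₁ C₁ εC P) - Δπ₂ (Emap H₂ C₂' εC ((LinearMap.toContinuousLinearMap ((jetLinearEquiv L η lev₀ lev₁ Dc₂).symm.toLinearMap ∘ₗ (jetLinearEquiv L η lev₀ lev₁ Dc₁).toLinearMap)) P)) =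
        (Δπ₁ (Emap H₁ C₁ εC P) - Δπ₂ ((LinearMap.toContinuousLinearMap ((jetLinearEquiv L η lev₀ lev₁ Dc₂).symm.toLinearMap ∘ₗ (jetLinearEquiv L η lev₀ lev₁ Dc₁).toLinearMap)) (Emap H₁ C₁ εC P))) + Δπ₂ ((LinearMap.toContinuousLinearMap ((jetLinearEquiv L η lev₀ lev₁ Dc₂).symm.toLinearMap ∘ₗ (jetLinearEquiv L η lev₀ lev₁ Dc₁).toLinearMap)) (Emap H₁ C₁ εC P) - Emap H₂ C₂' εC ((LinearMap.toContinuousLinearMap ((jetLinearEquiv L η lev₀ lev₁ Dc₂).symm.toLinearMap ∘ₗ (jetLinearEquiv L η lev₀ lev₁ Dc₁).toLinearMap)) P)) := by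
      rw [map_sub]; abel
    rw [e]
    refine (norm_add_le _ _).trans (add_le_add ?_ ?_)
    · exact (hmΔ _).trans (mul_le_mul_of_nonneg_left nE₁ hδΔ)
    · exact (Δπ₂.le_opNorm _).trans (mul_le_mul hΔ₂ vE (norm_nonneg _) hMΔ)
  have hV4 : RV / (4 * Kι) ≤ RV / 4 := div_le_div_of_nonneg_left hRV.le (by norm_num) (by linarith)
  have hℓr : ℓ * r ≤ RV / (4 * Kι) := by
    have h := mul_le_mul_of_nonneg_left hrV hℓ0.le
    rwa [show ℓ * (RV / (4 * Kι * ℓ)) = RV / (4 * Kι) by field_simp] at h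
  have hT₁P : ‖T47 H₁ C₁ εC P‖ < RV / (4 * Kι) := by
    have h1 : ‖T47 H₁ C₁ εC P‖ ≤ ℓ * ‖P‖ := by rw [hℓ, one_div, inv_mul_eq_div]; exact norm_T47_le RC₁ hPa
    exact h1.trans_lt ((mul_lt_mul_of_pos_left hP hℓ0).trans_le hℓr)
  have hT₁V : ‖T47 H₁ C₁ εC P‖ < RV := by linarith
  have hιT₁ : ‖(LinearMap.toContinuousLinearMap ((jetLinearEquiv L η lev₀ lev₁ Dc₂).symm.toLinearMap ∘ₗ (jetLinearEquiv L η lev₀ lev₁ Dc₁).toLinearMap)) (T47 H₁ C₁ εC P)‖ < RV / 2 := by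
    have h1 : ‖(LinearMap.toContinuousLinearMap ((jetLinearEquiv L η lev₀ lev₁ Dc₂).symm.toLinearMap ∘ₗ (jetLinearEquiv L η lev₀ lev₁ Dc₁).toLinearMap)) (T47 H₁ C₁ εC P)‖ ≤ Kι * ‖T47 H₁ C₁ εC P‖ := hι _
    have h2 : Kι * ‖T47 H₁ C₁ εC P‖ < Kι * (RV / (4 * Kι)) := mul_lt_mul_of_pos_left hT₁P hKι0
    have h3 : Kι * (RV / (4 * Kι)) = RV / 4 := by field_simp
    linarith
  have hT₂Q : ‖T47 H₂ C₂' εC ((LinearMap.toContinuousLinearMap ((jetLinearEquiv L η lev₀ lev₁ Dc₂).symm.toLinearMap ∘ₗ (jetLinearEquiv L η lev₀ lev₁ Dc₁).toLinearMap)) P)‖ < RV / 2 := by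
    have h1 : ‖T47 H₂ C₂' εC ((LinearMap.toContinuousLinearMap ((jetLinearEquiv L η lev₀ lev₁ Dc₂).symm.toLinearMap ∘ₗ (jetLinearEquiv L η lev₀ lev₁ Dc₁).toLinearMap)) P)‖ ≤ ℓ * ‖(LinearMap.toContinuousLinearMap ((jetLinearEquiv L η lev₀ lev₁ Dc₂).symm.toLinearMap ∘ₗ (jetLinearEquiv L η lev₀ lev₁ Dc₁).toLinearMap)) P‖ := by rw [hℓ, one_div, inv_mul_eq_div]; exact norm_T47_le RC₂ hιPa
    have h2 : ℓ * ‖(LinearMap.toContinuousLinearMap ((jetLinearEquiv L η lev₀ lev₁ Dc₂).symm.toLinearMap ∘ₗ (jetLinearEquiv L η lev₀ lev₁ Dc₁).toLinearMap)) P‖ ≤ ℓ * (Kι * ‖P‖) := mul_le_mul_of_nonneg_left hιP hℓ0.le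
    have h3 : ℓ * (Kι * ‖P‖) < ℓ * (Kι * r) := mul_lt_mul_of_pos_left (mul_lt_mul_of_pos_left hP hKι0) hℓ0
    have h4 : ℓ * (Kι * r) ≤ RV / 4 := by
      have h := mul_le_mul_of_nonneg_left hrV (mul_nonneg hℓ0.le hKι0.le)
      rw [show ℓ * Kι * (RV / (4 * Kι * ℓ)) = RV / 4 by field_simp] at h
      rw [← mul_assoc]; exact h
    linarith
  have nV : ‖curV0 (lev₁ := lev₁) (Dc := Dc₁) ρ τ U₁ (T47 H₁ C₁ εC P)‖ ≤ CV * RV ^ 2 :=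
    (hqV₁ _ hT₁V).trans (by gcongr)
  have hV₂ : Differentiable ℂ (curV0 (L := L) (η := η) (lev₀ := lev₀) (lev₁ := lev₁) (Dc := Dc₂) ρ τ U₂) :=
    (differentiable_curV0prime (lev₁ := lev₁) (Dc := Dc₂) ρ τ U₂).add (differentiable_curComm (lev₁ := lev₁) (Dc := Dc₂) ρ τ U₂)
  have bV : ‖curV0 (lev₁ := lev₁) (Dc := Dc₁) ρ τ U₁ (T47 H₁ C₁ εC P) -
      curV0 (lev₁ := lev₁) (Dc := Dc₂) ρ τ U₂ (T47 H₂ C₂' εC ((LinearMap.toContinuousLinearMap ((jetLinearEquiv L η lev₀ lev₁ Dc₂).symm.toLinearMap ∘ₗ (jetLinearEquiv L η lev₀ lev₁ Dc₁).toLinearMap)) P))‖ ≤ δV + 2 * CV * RV * δT := by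
    have e : curV0 (lev₁ := lev₁) (Dc := Dc₁) ρ τ U₁ (T47 H₁ C₁ εC P) - curV0 (lev₁ := lev₁) (Dc := Dc₂) ρ τ U₂ (T47 H₂ C₂' εC ((LinearMap.toContinuousLinearMap ((jetLinearEquiv L η lev₀ lev₁ Dc₂).symm.toLinearMap ∘ₗ (jetLinearEquiv L η lev₀ lev₁ Dc₁).toLinearMap)) P)) =
        (curV0 (lev₁ := lev₁) (Dc := Dc₁) ρ τ U₁ (T47 H₁ C₁ εC P) - curV0 (lev₁ := lev₁) (Dc := Dc₂) ρ τ U₂ ((LinearMap.toContinuousLinearMap ((jetLinearEquiv L η lev₀ lev₁ Dc₂).symm.toLinearMap ∘ₗ (jetLinearEquiv L η lev₀ lev₁ Dc₁).toLinearMap)) (T47 H₁ C₁ εC P))) +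
          (curV0 (lev₁ := lev₁) (Dc := Dc₂) ρ τ U₂ ((LinearMap.toContinuousLinearMap ((jetLinearEquiv L η lev₀ lev₁ Dc₂).symm.toLinearMap ∘ₗ (jetLinearEquiv L η lev₀ lev₁ Dc₁).toLinearMap)) (T47 H₁ C₁ εC P)) -
            curV0 (lev₁ := lev₁) (Dc := Dc₂) ρ τ U₂ (T47 H₂ C₂' εC ((LinearMap.toContinuousLinearMap ((jetLinearEquiv L η lev₀ lev₁ Dc₂).symm.toLinearMap ∘ₗ (jetLinearEquiv L η lev₀ lev₁ Dc₁).toLinearMap)) P))) := by abel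
    rw [e]
    refine (norm_add_le _ _).trans (add_le_add (hmV _ hT₁V) ?_)
    refine (norm_sub_le_of_quad_entire hV₂ hCV hRV hqV₂ hιT₁ hT₂Q).trans ?_
    exact mul_le_mul_of_nonneg_left vT (by positivity)
  -- the four groups
  have w₁ := norm_W1_sub_W1_le (ρ := ρ) (τ := τ) (H₁ := H₁) (C₁ := C₁) (H₂ := H₂) (C₂ := C₂') (εC₁ := εC) (εC₂ := εC) (P := P) hκ0 hκ J g3
  have w₂ := norm_W2_sub_W2_le (ρ := ρ) (τ := τ) hκ0 hκ Δπ₁ Δπ₂ gE dE bΔ nΔ aΔ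
  have w₃ := norm_W3_sub_W3_le (ρ := ρ) (τ := τ) hκ0 hκ Δπ₁ Δπ₂ gE dE bΔ mΔ
  have w₄ := norm_curV0full_sub_curV0full_le hκ0 hκ U₁ U₂ gT dT nV bV
  refine (norm_W80_sub_W80_le_of_groups U₁ U₂ J Δπ₁ Δπ₂ w₁ w₂ w₃ w₄).trans ?_
  have hT' : δT ≤ δT + δQ + δΔ + δV := by linarith
  have hQ' : δT + δQ ≤ δT + δQ + δΔ + δV := by linarith
  have hΔ' : δΔ ≤ δT + δQ + δΔ + δV := by linarith
  have hV' : δV ≤ δT + δQ + δΔ + δV := by linarith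
  have c₀ : 0 ≤ 2 * Kι / aC := by positivity
  have i₁ : ‖ρ‖ * ‖τ‖ * κc * (2 * Kι / aC * (δT + δQ) * ‖J‖) ≤ Mρ * Mτ * κc * (2 * Kι / aC * MJ) * (δT + δQ + δΔ + δV) := by
    have h1 : 2 * Kι / aC * (δT + δQ) * ‖J‖ ≤ 2 * Kι / aC * (δT + δQ + δΔ + δV) * MJ :=
      mul_le_mul (mul_le_mul_of_nonneg_left hQ' c₀) hJ (norm_nonneg _) (by positivity)
    refine (mul_le_mul hρτ h1 (by positivity) hA0).trans (le_of_eq ?_)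
    ring
  have i₂ : δΔ * εC + MΔ * δT + ‖ρ‖ * ‖τ‖ * κc * (2 * Kι / aC * δT * (MΔ * aC) + 2 * εC / aC * (δΔ * aC)) ≤
      ((εC + MΔ) + Mρ * Mτ * κc * (2 * Kι / aC * (MΔ * aC) + 2 * εC / aC * aC)) * (δT + δQ + δΔ + δV) := by
    have h1 : 2 * Kι / aC * δT * (MΔ * aC) + 2 * εC / aC * (δΔ * aC) ≤
        2 * Kι / aC * (δT + δQ + δΔ + δV) * (MΔ * aC) + 2 * εC / aC * ((δT + δQ + δΔ + δV) * aC) := by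
      gcongr
    have h2 := mul_le_mul hρτ h1 (by positivity) hA0
    have h3 : δΔ * εC + MΔ * δT ≤ (δT + δQ + δΔ + δV) * εC + MΔ * (δT + δQ + δΔ + δV) := by gcongr
    refine (add_le_add h3 h2).trans (le_of_eq ?_)
    ring
  have i₃ : ‖ρ‖ * ‖τ‖ * κc * (2 * Kι / aC * δT * (MΔ * εC) + 2 * εC / aC * (δΔ * εC + MΔ * δT)) ≤
      Mρ * Mτ * κc * (2 * Kι / aC * (MΔ * εC) + 2 * εC / aC * (εC + MΔ)) * (δT + δQ + δΔ + δV) := by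
    have h1 : 2 * Kι / aC * δT * (MΔ * εC) + 2 * εC / aC * (δΔ * εC + MΔ * δT) ≤
        2 * Kι / aC * (δT + δQ + δΔ + δV) * (MΔ * εC) +
          2 * εC / aC * ((δT + δQ + δΔ + δV) * εC + MΔ * (δT + δQ + δΔ + δV)) := by
      gcongr
    refine (mul_le_mul hρτ h1 (by positivity) hA0).trans (le_of_eq ?_)
    ring
  have i₄ : ‖ρ‖ * ‖τ‖ * κc * (2 * Kι / aC * δT * (CV * RV ^ 2) + 2 * (aC + εC) / aC * (δV + 2 * CV * RV * δT)) ≤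
      Mρ * Mτ * κc * (2 * Kι / aC * (CV * RV ^ 2) + 2 * (aC + εC) / aC * (1 + 2 * CV * RV)) * (δT + δQ + δΔ + δV) := by
    have h1 : 2 * Kι / aC * δT * (CV * RV ^ 2) + 2 * (aC + εC) / aC * (δV + 2 * CV * RV * δT) ≤
        2 * Kι / aC * (δT + δQ + δΔ + δV) * (CV * RV ^ 2) +
          2 * (aC + εC) / aC * ((δT + δQ + δΔ + δV) + 2 * CV * RV * (δT + δQ + δΔ + δV)) := by
      gcongr
    refine (mul_le_mul hρτ h1 (by positivity) hA0).trans (le_of_eq ?_)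
    ring
  linarith [i₁, i₂, i₃, i₄, Δ0]

end Point

/-! ## §2 The constant chosen before the carriers and the letters; the radius is the consumer's, under two caps -/

/-- **THE BACKGROUND MODULUS OF `W = (δ/δA′)V` REDUCED TO LETTER MODULI, ACROSS TWO CARRIERS (115)** — see the module header: with `K` chosen before
the carriers and the operator letters, for every radius `r ≤ a_C∕(2K_ι²)`, `r ≤ R_V∕(4K_ιℓ)` (the consumer's ball):
`‖W80(…₁)(P) − W80(…₂)(ιP)‖₍₋₃₎ ≤ K·(δ_T + δ_Q + δ_Δ + δ_V)` on `‖P‖ < r`, the four moduli displayed.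
NOT print's lattice-uniform constant; nothing of Prop. 4 ∕ (98) asserted. [folklore]
[cite: Balaban1985Variational, Prop. 4 (97)–(98) pp.292–293, Prop. 6 (117)–(121) p.295; Balaban1985BackgroundPropagators, Thm 3.4 p.400] -/
theorem exists_W80_background_modulus [CompleteSpace 𝒳] [CompleteSpace 𝔸] {b C₂ c₄ aC εC CV RV Mρ Mτ MJ MΔ MD Kι : ℝ}
    (haC : 0 < aC) (hεC : 0 ≤ εC) (hcontr : 4 * b * C₂ * (εC + aC) < 1) (hCV : 0 ≤ CV) (hRV : 0 < RV) (hMρ : 0 ≤ Mρ) (hMτ : 0 ≤ Mτ)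
    (hMJ : 0 ≤ MJ) (hMΔ : 0 ≤ MΔ) (hMD : 0 ≤ MD) (hKι : 1 ≤ Kι) :
    ∃ K : ℝ, 0 < K ∧ ∀ {r : ℝ}, r ≤ aC / (2 * Kι ^ 2) → r ≤ RV / (4 * Kι * (1 / (1 - 4 * b * C₂ * (εC + aC)))) →
      ∀ {Dc₁ Dc₂ : (Bond d Pd → 𝔸) →ₗ[ℂ] (κ' → 𝔸)}, (∀ g : Bond d Pd → 𝔸, ‖Dc₂ g‖ ≤ MD * ‖g‖) →
      (∀ P : Space115 L η lev₀ lev₁ Dc₁, ‖LinearMap.toContinuousLinearMap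
          ((jetLinearEquiv L η lev₀ lev₁ Dc₂).symm.toLinearMap ∘ₗ (jetLinearEquiv L η lev₀ lev₁ Dc₁).toLinearMap) P‖ ≤ Kι * ‖P‖) →
      (∀ Q : Space115 L η lev₀ lev₁ Dc₂, ‖LinearMap.toContinuousLinearMap
          ((jetLinearEquiv L η lev₀ lev₁ Dc₁).symm.toLinearMap ∘ₗ (jetLinearEquiv L η lev₀ lev₁ Dc₂).toLinearMap) Q‖ ≤ Kι * ‖Q‖) →
      ∀ {H₁ : 𝒳 →L[ℂ] Space115 L η lev₀ lev₁ Dc₁} {C₁ : Space115 L η lev₀ lev₁ Dc₁ → 𝒳}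
        {H₂ : 𝒳 →L[ℂ] Space115 L η lev₀ lev₁ Dc₂} {C₂' : Space115 L η lev₀ lev₁ Dc₂ → 𝒳},
        Regime H₁ 0 C₁ b 0 C₂ c₄ 0 aC εC → Prop4Hyp C₁ C₂ c₄ → Regime H₂ 0 C₂' b 0 C₂ c₄ 0 aC εC → Prop4Hyp C₂' C₂ c₄ →
      ∀ (ρ : (𝔸 →L[ℂ] ℂ) →L[ℂ] 𝔸) (τ : 𝔸 →L[ℂ] ℂ) (U₁ U₂ : Bond d Pd → 𝔸ˣ), ‖ρ‖ ≤ Mρ → ‖τ‖ ≤ Mτ →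
        (∀ Y : Space115 L η lev₀ lev₁ Dc₁, ‖Y‖ < RV → ‖curV0 (lev₁ := lev₁) (Dc := Dc₁) ρ τ U₁ Y‖ ≤ CV * ‖Y‖ ^ 2) →
        (∀ Y : Space115 L η lev₀ lev₁ Dc₂, ‖Y‖ < RV → ‖curV0 (lev₁ := lev₁) (Dc := Dc₂) ρ τ U₂ Y‖ ≤ CV * ‖Y‖ ^ 2) →
      ∀ (J : NegSize L η lev₀ 3 𝔸) (Δπ₁ : Space115 L η lev₀ lev₁ Dc₁ →L[ℂ] NegSize L η lev₀ 3 𝔸)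
        (Δπ₂ : Space115 L η lev₀ lev₁ Dc₂ →L[ℂ] NegSize L η lev₀ 3 𝔸), ‖J‖ ≤ MJ → ‖Δπ₁‖ ≤ MΔ → ‖Δπ₂‖ ≤ MΔ →
      ∀ {δT δQ δΔ δV : ℝ}, 0 ≤ δT → 0 ≤ δQ → 0 ≤ δΔ → 0 ≤ δV →
        (∀ x : Space115 L η lev₀ lev₁ Dc₁, ‖x‖ < aC →
          ‖LinearMap.toContinuousLinearMap
            ((jetLinearEquiv L η lev₀ lev₁ Dc₂).symm.toLinearMap ∘ₗ (jetLinearEquiv L η lev₀ lev₁ Dc₁).toLinearMap) x‖ < aC →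
          ‖LinearMap.toContinuousLinearMap
              ((jetLinearEquiv L η lev₀ lev₁ Dc₂).symm.toLinearMap ∘ₗ (jetLinearEquiv L η lev₀ lev₁ Dc₁).toLinearMap)
              (x + solA H₁ 0 C₁ 0 εC x) -
            (LinearMap.toContinuousLinearMap
              ((jetLinearEquiv L η lev₀ lev₁ Dc₂).symm.toLinearMap ∘ₗ (jetLinearEquiv L η lev₀ lev₁ Dc₁).toLinearMap) x +
              solA H₂ 0 C₂' 0 εC (LinearMap.toContinuousLinearMap
                ((jetLinearEquiv L η lev₀ lev₁ Dc₂).symm.toLinearMap ∘ₗ (jetLinearEquiv L η lev₀ lev₁ Dc₁).toLinearMap) x))‖ ≤ δT) →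
        (∀ x : Space115 L η lev₀ lev₁ Dc₁, ‖x‖ < aC →
          ‖LinearMap.toContinuousLinearMap
            ((jetLinearEquiv L η lev₀ lev₁ Dc₂).symm.toLinearMap ∘ₗ (jetLinearEquiv L η lev₀ lev₁ Dc₁).toLinearMap) x‖ < aC →
          ‖LinearMap.toContinuousLinearMap
              ((jetLinearEquiv L η lev₀ lev₁ Dc₂).symm.toLinearMap ∘ₗ (jetLinearEquiv L η lev₀ lev₁ Dc₁).toLinearMap)
              (H₁ (quadPart C₁ x)) -
            H₂ (quadPart C₂' (LinearMap.toContinuousLinearMap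
              ((jetLinearEquiv L η lev₀ lev₁ Dc₂).symm.toLinearMap ∘ₗ (jetLinearEquiv L η lev₀ lev₁ Dc₁).toLinearMap) x))‖ ≤ δQ) →
        (∀ Y : Space115 L η lev₀ lev₁ Dc₁, ‖Δπ₁ Y - Δπ₂ (LinearMap.toContinuousLinearMap
            ((jetLinearEquiv L η lev₀ lev₁ Dc₂).symm.toLinearMap ∘ₗ (jetLinearEquiv L η lev₀ lev₁ Dc₁).toLinearMap) Y)‖ ≤ δΔ * ‖Y‖) →
        (∀ Y : Space115 L η lev₀ lev₁ Dc₁, ‖Y‖ < RV →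
          ‖curV0 (lev₁ := lev₁) (Dc := Dc₁) ρ τ U₁ Y - curV0 (lev₁ := lev₁) (Dc := Dc₂) ρ τ U₂ (LinearMap.toContinuousLinearMap
            ((jetLinearEquiv L η lev₀ lev₁ Dc₂).symm.toLinearMap ∘ₗ (jetLinearEquiv L η lev₀ lev₁ Dc₁).toLinearMap) Y)‖ ≤ δV) →
      ∀ P : Space115 L η lev₀ lev₁ Dc₁, ‖P‖ < r →
        ‖W80 ρ τ U₁ H₁ C₁ εC J Δπ₁ P - W80 ρ τ U₂ H₂ C₂' εC J Δπ₂ (LinearMap.toContinuousLinearMap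
            ((jetLinearEquiv L η lev₀ lev₁ Dc₂).symm.toLinearMap ∘ₗ (jetLinearEquiv L η lev₀ lev₁ Dc₁).toLinearMap) P)‖ ≤
          K * (δT + δQ + δΔ + δV) := by
  -- the column constant `κ̄(M_D)` of `B11Ineq73KernelLettersUniform.colConst_le`
  obtain ⟨κc, hκc⟩ : ∃ κc : ℝ, κc = ∑ bb : Bond d Pd, ∑ b' : Bond d Pd, levWeight L η lev₀ 3 bb / levWeight L η lev₀ 3 b'
      * (levWeight L η lev₀ 1 b')⁻¹ * max (levWeight L η lev₀ 1 bb) ((NegSup.wSup (levWeight L η lev₁ 2) : ℝ) * MD) := ⟨_, rfl⟩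
  have hw : ∀ bb : Bond d Pd, 0 < levWeight L η lev₀ 3 bb := levWeight_pos (Fact.out : 0 < L) (Fact.out : 0 < η) lev₀ 3
  have hw1 : ∀ bb : Bond d Pd, 0 < levWeight L η lev₀ 1 bb := levWeight_pos (Fact.out : 0 < L) (Fact.out : 0 < η) lev₀ 1
  have hκ0 : 0 ≤ κc := by
    rw [hκc]
    exact Finset.sum_nonneg fun bb _ => Finset.sum_nonneg fun b' _ => by
      have := (hw bb).le; have := (hw b').le; have := (hw1 b').le
      have : 0 ≤ max (levWeight L η lev₀ 1 bb) ((NegSup.wSup (levWeight L η lev₁ 2) : ℝ) * MD) := le_max_of_le_left (hw1 bb).le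
      positivity
  refine ⟨(Mρ * Mτ * κc * (2 * Kι / aC * MJ) + ((εC + MΔ) + Mρ * Mτ * κc * (2 * Kι / aC * (MΔ * aC) + 2 * εC / aC * aC))
      + Mρ * Mτ * κc * (2 * Kι / aC * (MΔ * εC) + 2 * εC / aC * (εC + MΔ))
      + Mρ * Mτ * κc * (2 * Kι / aC * (CV * RV ^ 2) + 2 * (aC + εC) / aC * (1 + 2 * CV * RV)) + 1), by positivity, ?_⟩
  intro r hra hrV Dc₁ Dc₂ hD₂ hι hκι H₁ C₁ H₂ C₂' RC₁ hC₁ RC₂ hC₂ ρ τ U₁ U₂ hρ hτ hqV₁ hqV₂ J Δπ₁ Δπ₂ hJ hΔ₁ hΔ₂ δT δQ δΔ δV hδT hδQ hδΔ hδV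
    hmT hmQ hmΔ hmV P hP
  have hκ : ∀ (N : Space115 L η lev₀ lev₁ Dc₂ →L[ℂ] Space115 L η lev₀ lev₁ Dc₂) (bb : Bond d Pd),
      ∑ b' : Bond d Pd, levWeight L η lev₀ 3 bb / levWeight L η lev₀ 3 b' * ‖kernel N b' bb‖ ≤ κc * ‖N‖ := fun N bb => by
    rw [hκc]; exact (colSum_kernel_le N bb).trans (mul_le_mul_of_nonneg_right (colConst_le hMD hD₂) (norm_nonneg N))
  exact norm_W80_sub_W80_le_at haC hεC hcontr hCV hRV hMρ hMΔ hKι hκ0 hκ hι hκι RC₁ hC₁ RC₂ hC₂ hρ hτ hqV₁ hqV₂ hJ hΔ₁ hΔ₂ hδT hδQ hδΔ hδV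
    hmT hmQ hmΔ hmV hra hrV hP

end Literature.MathematicalPhysics.QuantumFieldTheory.Balaban1983to89.B11Eq98W80BackgroundModulus

end
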